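import Literature.Analysis.FluidPDE.PeriodicLerayCompactness
import Literature.Analysis.FluidPDE.LocalEnergyLimitVelocity
import HarnessLib

/-!
# [BT1] proof of Theorem 2.4, the limit `ε → 0`, II: one subsequence and one limit velocity on
  space–time; `L^{10/3}` bounds and `L³` convergence on every cylinder

Analysis/FluidPDE proof file (theorems only, no new definitions, no named facts), second part
of the discharge of the named fact `Literature.Analysis.FluidPDE.bradshawTsai2017_thm_2_4_limit`
(`PeriodicLerayExistence.lean`; Bradshaw–Tsai, Ann. Henri Poincaré 18 (2017) =
arXiv:1510.07504 [BT1], §2, proof of Thm 2.4, the limit `ε → 0`): "there exists a vector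
field `U ∈ L^∞(0,T;L²(ℝ³)) ∩ L²(0,T;H¹₀(ℝ³))` and a sequence `{U_{ε_k}}` … so that …
`U_{ε_k} → U` strongly in `L²(0,T;L²(K))` for all compact sets `K ⊂ ℝ³`".

Given `T`-periodic weak solutions `(U_k, p_k)` of the mollified perturbed Leray systems at scales
`ε_k > 0` with a common bound `C` (`IsMollifiedPeriodicWeakSolution T W η ε_k C U_k p_k`), this
file extracts **one** subsequence `φ` and **one** jointly measurable limit `u` on `ℝ × ℝ³` with
`U_{φ k} → u` strongly in `L²` and in `L³` of every cylinder
`Q_n = (−n−1, n+1) × B(0, n+1)`, together with the uniform `L^{10/3}(Q_n)` bounds, the slice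
energy bound `∫_{B(0,n+1)} |u(t)|² ≤ C` for a.e. `t`, and the convergence of the slice pairings
for a.e. `t`:

* `IsMollifiedPeriodicWeakSolution.lintegral_cylinder_tenThirds_le` — the uniform bound
  `∫∫_{(a,b)×B(0,R)} |U|^{10/3} ≤ M(T, C, R, b − a)` (the tree's
  `Seregin2014Limit.exists_tenThirds_bound` on `(0, T) × B(0, R)`, extended to bounded windows
  by periodicity);
* `exists_velocity_limit` — Cantor's diagonal procedure over the exhaustion `Q_n`
  (`FunctionSpaces.exists_strictMono_forall_of_extraction`) on the compactness theorem of
  `PeriodicLerayCompactness` (`exists_subseq_strong_limit_velocity`), gluing of the limits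
  (`FunctionSpaces.exists_glue_of_ae_eq`, `L²` limits being unique), and the interpolation
  `L² ∩ L^{10/3} ⊂ L³` (`FunctionSpaces.tendsto_lintegral_enorm_rpow_three_of_sq_of_tenThirds`);
  verbatim the architecture of the tree's `Seregin2014Limit.exists_velocity_limit`;
* `ae_lintegral_sq_le_of_forall_ball` — the global slice bound `∫_{ℝ³} |u(t)|² ≤ C` for a.e. `t`.

## References

* Z. Bradshaw, T.-P. Tsai, Ann. Henri Poincaré 18 (2017) 1095–1119 = arXiv:1510.07504, §2,
  proof of Thm 2.4 (the limit `ε → 0`) [BradshawTsai2017AHP].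
* G. Seregin, *Lecture Notes on Regularity Theory for the Navier–Stokes Equations* (2014),
  App. B §B.4 (the diagonal procedure) [Seregin2014].
* R. Temam, *Navier–Stokes equations* (1977/79), Ch. III, §2–§3 [Temam1979].
-/

noncomputable section

open MeasureTheory TopologicalSpace Set Function Filter Metric Bornology
open scoped NNReal ENNReal Topology InnerProductSpace RealInnerProductSpace

namespace Literature.Analysis.FluidPDE

namespace BradshawTsai2017

/-! ### The uniform `L^{10/3}` bound on cylinders -/

section TenThirds

variable {T : ℝ} {W : ℝ → (EuclideanSpace ℝ (Fin 3)) → (EuclideanSpace ℝ (Fin 3))}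
  {η : (EuclideanSpace ℝ (Fin 3)) → ℝ} {ε : ℝ} {C : ℝ≥0}
  {U : ℝ → (EuclideanSpace ℝ (Fin 3)) → (EuclideanSpace ℝ (Fin 3))}
  {p : ℝ → (EuclideanSpace ℝ (Fin 3)) → ℝ}

/-- A lower integral over `S × B` is the lower integral over `S × univ` of the integrand cut off
by the indicator of `B` in the space variable. [folklore] -/
theorem setLIntegral_prod_eq_setLIntegral_prod_univ_indicator {S : Set ℝ}
    {B : Set (EuclideanSpace ℝ (Fin 3))} (hB : MeasurableSet B)
    (g : ℝ × (EuclideanSpace ℝ (Fin 3)) → ℝ≥0∞) :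
    ∫⁻ z in S ×ˢ B, g z =
      ∫⁻ z in S ×ˢ (univ : Set (EuclideanSpace ℝ (Fin 3))),
        B.indicator (fun _ => (1 : ℝ≥0∞)) z.2 * g z := by
  have heq : (fun z : ℝ × (EuclideanSpace ℝ (Fin 3)) => B.indicator (fun _ => (1 : ℝ≥0∞)) z.2 * g z) =
      ((univ : Set ℝ) ×ˢ B).indicator g := by
    funext z
    by_cases hz : z.2 ∈ B
    · rw [indicator_of_mem hz, one_mul, indicator_of_mem (show z ∈ (univ : Set ℝ) ×ˢ B from
        ⟨mem_univ _, hz⟩)]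
    · rw [indicator_of_notMem hz, zero_mul, indicator_of_notMem (show z ∉ (univ : Set ℝ) ×ˢ B from
        fun h => hz h.2)]
  rw [heq, lintegral_indicator (MeasurableSet.univ.prod hB), Measure.restrict_restrict
    (MeasurableSet.univ.prod hB), Set.prod_inter_prod, univ_inter, inter_univ]

/-- **The uniform `L^{10/3}` bound on cylinders** ([BT1] p. 10: "`U_ε` … in
`L^{10/3}(ℝ³ × [0,T])`"; the multiplicative inequality `L^∞L² ∩ L²H¹ ⊂ L^{10/3}`). For `T > 0`,
`C` and a cylinder `(a, b) × B(0, R)` there is `M < ∞` such that every `T`-periodic weak solution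
of a mollified perturbed Leray system with bound `C` satisfies `∫∫_{(a,b)×B(0,R)} |U|^{10/3} ≤ M`
(the tree's `Seregin2014Limit.exists_tenThirds_bound` on `(0, T) × B(0, R)` from the energy bound
and `∫∫_{(0,T)×ℝ³} |∇U|² ≤ C`, then periodicity in time). [cite: BradshawTsai2017AHP, proof of Thm 2.4 ("U_ε … L^{10/3}(ℝ³ × [0,T])")] -/
theorem exists_cylinder_tenThirds_bound (hT : 0 < T) (C : ℝ≥0) (a b R : ℝ) :
    ∃ M : ℝ≥0∞, M < ∞ ∧ ∀ {W : ℝ → (EuclideanSpace ℝ (Fin 3)) → (EuclideanSpace ℝ (Fin 3))}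
      {η : (EuclideanSpace ℝ (Fin 3)) → ℝ} {ε : ℝ}
      {U : ℝ → (EuclideanSpace ℝ (Fin 3)) → (EuclideanSpace ℝ (Fin 3))}
      {p : ℝ → (EuclideanSpace ℝ (Fin 3)) → ℝ},
      IsMollifiedPeriodicWeakSolution T W η ε C U p →
        ∫⁻ z in Ioo a b ×ˢ ball (0 : EuclideanSpace ℝ (Fin 3)) R, ‖U z.1 z.2‖ₑ ^ (10 / 3 : ℝ) ≤ M := by
  obtain ⟨M₀, hM₀, hMb⟩ := Seregin2014Limit.exists_tenThirds_bound hT C R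
  refine ⟨2 * (⌈(b - a) / T⌉₊ + 1 : ℕ) * M₀,
    ENNReal.mul_lt_top (ENNReal.mul_lt_top ENNReal.ofNat_lt_top (ENNReal.natCast_lt_top _)) hM₀,
    fun {W η ε U p} h => ?_⟩
  obtain ⟨G, hG, hGb, -, -⟩ := h.weakForm
  -- the bound on `(0, T) × B(0, R)`
  have h0 : ∫⁻ z in Ioo 0 T ×ˢ ball (0 : EuclideanSpace ℝ (Fin 3)) R, ‖U z.1 z.2‖ₑ ^ (10 / 3 : ℝ) ≤ M₀ := by
    refine hMb U G (hG.mono le_top) ?_ fun x₀ => ?_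
    · exact Eventually.of_forall fun t x₀ => (setLIntegral_le_lintegral _ _).trans (h.energy_le t)
    · exact (lintegral_mono_set (prod_mono Subset.rfl (subset_univ _))).trans hGb
  -- periodicity in time
  have hm : AEMeasurable (fun z : ℝ × (EuclideanSpace ℝ (Fin 3)) =>
      (ball (0 : EuclideanSpace ℝ (Fin 3)) R).indicator (fun _ => (1 : ℝ≥0∞)) z.2 *
        ‖U z.1 z.2‖ₑ ^ (10 / 3 : ℝ)) volume :=
    ((aemeasurable_indicator_const_iff (1 : ℝ≥0∞)).2 (measurableSet_ball.nullMeasurableSet)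
      |>.comp_snd).mul (h.aestronglyMeasurable_velocity.enorm.pow_const _)
  rw [setLIntegral_prod_eq_setLIntegral_prod_univ_indicator measurableSet_ball] at h0 ⊢
  refine (setLIntegral_Ioo_prod_le_of_periodic hT (fun s y => ?_) a b).trans
    (mul_le_mul' le_rfl h0)
  simp only [h.periodic s y]

end TenThirds

/-! ### One subsequence and one limit velocity on space–time -/

section Limit

variable {T : ℝ} {W : ℝ → (EuclideanSpace ℝ (Fin 3)) → (EuclideanSpace ℝ (Fin 3))}
  {η : (EuclideanSpace ℝ (Fin 3)) → ℝ} {C : ℝ≥0}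

/-- **The velocity part of the limit `ε → 0`: one subsequence, one limit on `ℝ × ℝ³`** ([BT1],
proof of Thm 2.4: "there exists a vector field `U` … and a sequence `{U_{ε_k}}` … so that …
`U_{ε_k} → U` strongly in `L²(0,T;L²(K))` for all compact sets `K ⊂ ℝ³`"; the diagonal
procedure of Seregin 2014, App. B §B.4). Let `(U_k, p_k)` be `T`-periodic weak solutions of the
mollified perturbed Leray systems at scales `ε_k > 0` around a `C¹` profile `W` with a common
bound `C`. Then along a subsequence `φ` the `U_{φ k}` converge, strongly in `L²` and in `L³` of
the cylinder `Q_n = (−n−1, n+1) × B(0, n+1)` for every `n`, to one jointly measurable field `u`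
on `ℝ × ℝ³` with `∫_{B(0,n+1)} |u(t)|² ≤ C` for a.e. `t ∈ (−n−1, n+1)`; the `U_k` and `u` obey a
uniform `L^{10/3}(Q_n)` bound; and for every test function `θ` on `B(0, n+1)` the slice pairings
`∫ θ • U_{φ k}(t) → ∫ θ • u(t)` for a.e. `t ∈ (−n−1, n+1)`. [cite: BradshawTsai2017AHP, proof of Thm 2.4 (limit ε → 0)] -/
theorem exists_velocity_limit (hT : 0 < T) (hW : ContDiff ℝ 1 (uncurry W))
    (hη : IsMollifyingKernel η) {ε : ℕ → ℝ} (hε : ∀ k, 0 < ε k)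
    {U : ℕ → ℝ → (EuclideanSpace ℝ (Fin 3)) → (EuclideanSpace ℝ (Fin 3))}
    {p : ℕ → ℝ → (EuclideanSpace ℝ (Fin 3)) → ℝ}
    (hsol : ∀ k, IsMollifiedPeriodicWeakSolution T W η (ε k) C (U k) (p k)) :
    ∃ (φ : ℕ → ℕ) (u : ℝ → (EuclideanSpace ℝ (Fin 3)) → (EuclideanSpace ℝ (Fin 3))), StrictMono φ ∧
      AEStronglyMeasurable (uncurry u) (volume : Measure (ℝ × EuclideanSpace ℝ (Fin 3))) ∧
      (∀ n : ℕ, ∀ᵐ t ∂(volume.restrict (Ioo (-((n : ℝ) + 1)) ((n : ℝ) + 1))),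
        ∫⁻ x in ball (0 : EuclideanSpace ℝ (Fin 3)) (n + 1), ‖u t x‖ₑ ^ 2 ≤ C) ∧
      (∀ n : ℕ, ∃ M : ℝ≥0∞, M < ∞ ∧
        (∀ k, ∫⁻ z in Ioo (-((n : ℝ) + 1)) ((n : ℝ) + 1) ×ˢ ball (0 : EuclideanSpace ℝ (Fin 3)) (n + 1),
          ‖U k z.1 z.2‖ₑ ^ (10 / 3 : ℝ) ≤ M) ∧
        ∫⁻ z in Ioo (-((n : ℝ) + 1)) ((n : ℝ) + 1) ×ˢ ball (0 : EuclideanSpace ℝ (Fin 3)) (n + 1),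
          ‖u z.1 z.2‖ₑ ^ (10 / 3 : ℝ) ≤ M) ∧
      (∀ n : ℕ, Tendsto (fun k => ∫⁻ z in Ioo (-((n : ℝ) + 1)) ((n : ℝ) + 1) ×ˢ
          ball (0 : EuclideanSpace ℝ (Fin 3)) (n + 1), ‖U (φ k) z.1 z.2 - u z.1 z.2‖ₑ ^ 2)
        atTop (𝓝 0)) ∧
      (∀ n : ℕ, Tendsto (fun k => ∫⁻ z in Ioo (-((n : ℝ) + 1)) ((n : ℝ) + 1) ×ˢ
          ball (0 : EuclideanSpace ℝ (Fin 3)) (n + 1), ‖U (φ k) z.1 z.2 - u z.1 z.2‖ₑ ^ (3 : ℝ))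
        atTop (𝓝 0)) ∧
      (∀ n : ℕ, ∀ θ : (EuclideanSpace ℝ (Fin 3)) → ℝ,
        FunctionSpaces.IsTestFunctionOn
          (⟨ball (0 : EuclideanSpace ℝ (Fin 3)) (n + 1), isOpen_ball⟩ : Opens (EuclideanSpace ℝ (Fin 3))) θ →
        ∀ᵐ t ∂(volume.restrict (Ioo (-((n : ℝ) + 1)) ((n : ℝ) + 1))),
          Tendsto (fun k => ∫ x in ball (0 : EuclideanSpace ℝ (Fin 3)) (n + 1), θ x • U (φ k) t x)
            atTop (𝓝 (∫ x in ball (0 : EuclideanSpace ℝ (Fin 3)) (n + 1), θ x • u t x))) := by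
  -- the cylinders `Q n = (−n−1, n+1) × B(0, n + 1)`
  set I : ℕ → Set ℝ := fun n => Ioo (-((n : ℝ) + 1)) ((n : ℝ) + 1) with hI
  set Ω : ℕ → Opens (EuclideanSpace ℝ (Fin 3)) := fun n =>
    ⟨ball (0 : EuclideanSpace ℝ (Fin 3)) (n + 1), isOpen_ball⟩ with hΩ
  set Q : ℕ → Set (ℝ × EuclideanSpace ℝ (Fin 3)) := fun n =>
    Ioo (-((n : ℝ) + 1)) ((n : ℝ) + 1) ×ˢ ball (0 : EuclideanSpace ℝ (Fin 3)) (n + 1) with hQ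
  have hQm : ∀ n, MeasurableSet (Q n) := fun n => measurableSet_Ioo.prod measurableSet_ball
  have hQmono : ∀ {n m : ℕ}, n ≤ m → Q n ⊆ Q m := fun {n m} h => by
    have : (n : ℝ) ≤ m := Nat.cast_le.2 h
    exact Set.prod_mono (Ioo_subset_Ioo (by linarith) (by linarith)) (ball_subset_ball (by linarith))
  -- measurability of the `U k` on the cylinders
  have hvm : ∀ k n, AEStronglyMeasurable (uncurry (U k)) (volume.restrict (Q n)) := fun k n =>
    (hsol k).aestronglyMeasurable_velocity.restrict
  -- the extraction property on `Q n`
  let P : ℕ → (ℕ → ℕ) → Prop := fun n φ =>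
    ∃ w : ℝ → (EuclideanSpace ℝ (Fin 3)) → (EuclideanSpace ℝ (Fin 3)),
      AEStronglyMeasurable (uncurry w) (volume.restrict (Q n)) ∧
      (∀ᵐ t ∂(volume.restrict (I n)),
        ∫⁻ x in ball (0 : EuclideanSpace ℝ (Fin 3)) (n + 1), ‖w t x‖ₑ ^ 2 ≤ C) ∧
      Tendsto (fun k => ∫⁻ z in Q n, ‖U (φ k) z.1 z.2 - w z.1 z.2‖ₑ ^ 2) atTop (𝓝 0) ∧
      ∀ θ : (EuclideanSpace ℝ (Fin 3)) → ℝ, FunctionSpaces.IsTestFunctionOn (Ω n) θ →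
        ∀ᵐ t ∂(volume.restrict (I n)),
          Tendsto (fun k => ∫ x in ball (0 : EuclideanSpace ℝ (Fin 3)) (n + 1), θ x • U (φ k) t x)
            atTop (𝓝 (∫ x in ball (0 : EuclideanSpace ℝ (Fin 3)) (n + 1), θ x • w t x))
  have hsub : ∀ n (φ φ' : ℕ → ℕ), (∃ ρ : ℕ → ℕ, StrictMono ρ ∧ ∀ᶠ k in atTop, φ' k = φ (ρ k)) →
      P n φ → P n φ' := by
    rintro n φ φ' ⟨ρ, hρ, heq⟩ ⟨w, hwm, hwb, hwt, hwP⟩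
    refine ⟨w, hwm, hwb, FunctionSpaces.tendsto_of_eventually_eq_comp
      (a := fun j => ∫⁻ z in Q n, ‖U j z.1 z.2 - w z.1 z.2‖ₑ ^ 2) hρ heq hwt, fun θ hθ => ?_⟩
    filter_upwards [hwP θ hθ] with t ht
    exact FunctionSpaces.tendsto_of_eventually_eq_comp
      (a := fun j => ∫ x in ball (0 : EuclideanSpace ℝ (Fin 3)) (n + 1), θ x • U j t x) hρ heq ht
  have hex : ∀ n (φ : ℕ → ℕ), StrictMono φ → ∃ ψ : ℕ → ℕ, StrictMono ψ ∧ P n (φ ∘ ψ) := by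
    intro n φ hφ
    obtain ⟨σ, w, hσ, hwm, hwb, hwt, hwP⟩ :=
      exists_subseq_strong_limit_velocity (U := fun k => U (φ k)) (p := fun k => p (φ k))
        hT hW hη (fun k => hε (φ k)) (fun k => hsol (φ k)) (-((n : ℝ) + 1)) ((n : ℝ) + 1)
        (0 : EuclideanSpace ℝ (Fin 3)) ((n : ℝ) + 1)
    exact ⟨σ, hσ, w, hwm, hwb, hwt, hwP⟩
  obtain ⟨φ, hφ, hP⟩ := FunctionSpaces.exists_strictMono_forall_of_extraction hsub hex
  choose w hwm hwb hwt hwP using hP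
  -- the limits agree on the smaller cylinder
  have hcons : ∀ n m, n ≤ m → ∀ᵐ z ∂(volume.restrict (Q n)), uncurry (w n) z = uncurry (w m) z := by
    intro n m hnm
    have hwt' : Tendsto (fun k => ∫⁻ z in Q n, ‖U (φ k) z.1 z.2 - w m z.1 z.2‖ₑ ^ 2) atTop (𝓝 0) :=
      tendsto_of_tendsto_of_tendsto_of_le_of_le tendsto_const_nhds (hwt m) (fun _ => bot_le)
        fun _ => lintegral_mono_set (hQmono hnm)
    exact Seregin2014Limit.ae_eq_of_tendsto_lintegral_sub_sq (f := fun k => uncurry (U (φ k)))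
      (fun k => hvm (φ k) n) (hwm n)
      ((hwm m).mono_measure (Measure.restrict_mono (hQmono hnm) le_rfl)) (hwt n) hwt'
  -- glue along the exhaustion, indexed by `N z = max ⌊|z.1|⌋₊ ⌊‖z.2‖⌋₊`
  set N : ℝ × EuclideanSpace ℝ (Fin 3) → ℕ := fun z => max ⌊|z.1|⌋₊ ⌊‖z.2‖⌋₊ with hN
  have hmemQ : ∀ z : ℝ × EuclideanSpace ℝ (Fin 3), z ∈ Q (N z) := by
    intro z
    have h1 : |z.1| < ⌊|z.1|⌋₊ + 1 := Nat.lt_floor_add_one _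
    have h2 : ‖z.2‖ < ⌊‖z.2‖⌋₊ + 1 := Nat.lt_floor_add_one _
    have h3 : (⌊|z.1|⌋₊ : ℝ) ≤ N z := Nat.cast_le.2 (le_max_left _ _)
    have h4 : (⌊‖z.2‖⌋₊ : ℝ) ≤ N z := Nat.cast_le.2 (le_max_right _ _)
    refine ⟨⟨?_, ?_⟩, ?_⟩
    · linarith [neg_abs_le z.1]
    · linarith [le_abs_self z.1]
    · rw [mem_ball_zero_iff]; linarith
  have hNS : ∀ z ∈ ⋃ n, Q n, z ∈ Q (N z) := fun z _ => hmemQ z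
  have hNle : ∀ n, ∀ z ∈ Q n, N z ≤ n := by
    intro n z hz
    have h1 : |z.1| < n + 1 := abs_lt.2 ⟨hz.1.1, hz.1.2⟩
    have h2 : ‖z.2‖ < n + 1 := by
      have := hz.2
      rwa [mem_ball_zero_iff] at this
    have h3 : ⌊|z.1|⌋₊ < n + 1 := (Nat.floor_lt (abs_nonneg _)).2 (by exact_mod_cast h1)
    have h4 : ⌊‖z.2‖⌋₊ < n + 1 := (Nat.floor_lt (norm_nonneg _)).2 (by exact_mod_cast h2)
    exact max_le (by omega) (by omega)
  obtain ⟨Ug, hU, hUm⟩ := FunctionSpaces.exists_glue_of_ae_eq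
    (μ := (volume : Measure (ℝ × EuclideanSpace ℝ (Fin 3)))) hQm N hNS hNle (fun n => uncurry (w n)) hcons
  have hUnion : (⋃ n, Q n) = (univ : Set (ℝ × EuclideanSpace ℝ (Fin 3))) :=
    eq_univ_of_forall fun z => mem_iUnion.2 ⟨N z, hmemQ z⟩
  have hUmeas : AEStronglyMeasurable Ug (volume : Measure (ℝ × EuclideanSpace ℝ (Fin 3))) := by
    have h1 := hUm hwm
    rwa [hUnion, Measure.restrict_univ] at h1
  set u : ℝ → (EuclideanSpace ℝ (Fin 3)) → (EuclideanSpace ℝ (Fin 3)) := fun t x => Ug (t, x) with hu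
  have huU : uncurry u = Ug := rfl
  have hum : ∀ n, AEStronglyMeasurable (uncurry u) (volume.restrict (Q n)) := fun n =>
    hUmeas.restrict
  -- transfer of the convergence, the slice bounds and the pairings
  have hut : ∀ n, Tendsto (fun k => ∫⁻ z in Q n, ‖U (φ k) z.1 z.2 - u z.1 z.2‖ₑ ^ 2) atTop (𝓝 0) := by
    intro n
    refine (hwt n).congr fun k => lintegral_congr_ae ?_
    filter_upwards [hU n] with z hz
    change ‖U (φ k) z.1 z.2 - uncurry (w n) z‖ₑ ^ 2 = ‖U (φ k) z.1 z.2 - Ug (z.1, z.2)‖ₑ ^ 2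
    rw [← hz]
  have hbox : ∀ n, ∀ᵐ t ∂(volume.restrict (I n)),
      ∀ᵐ x ∂(volume.restrict (ball (0 : EuclideanSpace ℝ (Fin 3)) (n + 1))), Ug (t, x) = uncurry (w n) (t, x) := by
    intro n
    have h1 := hU n
    have hprod : (volume.restrict (Q n)) = ((volume : Measure ℝ).restrict (I n)).prod
        ((volume : Measure (EuclideanSpace ℝ (Fin 3))).restrict (ball (0 : EuclideanSpace ℝ (Fin 3)) (n + 1))) := by
      rw [hQ, Measure.volume_eq_prod, Measure.prod_restrict]
    rw [hprod] at h1
    exact Measure.ae_ae_of_ae_prod h1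
  have hub : ∀ n : ℕ, ∀ᵐ t ∂(volume.restrict (I n)),
      ∫⁻ x in ball (0 : EuclideanSpace ℝ (Fin 3)) (n + 1), ‖u t x‖ₑ ^ 2 ≤ C := by
    intro n
    filter_upwards [hwb n, hbox n] with t ht ht'
    refine le_of_eq_of_le (lintegral_congr_ae ?_) ht
    filter_upwards [ht'] with x hx
    change ‖Ug (t, x)‖ₑ ^ 2 = ‖uncurry (w n) (t, x)‖ₑ ^ 2
    rw [hx]
  have huP : ∀ n (θ : (EuclideanSpace ℝ (Fin 3)) → ℝ), FunctionSpaces.IsTestFunctionOn (Ω n) θ →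
      ∀ᵐ t ∂(volume.restrict (I n)),
        Tendsto (fun k => ∫ x in ball (0 : EuclideanSpace ℝ (Fin 3)) (n + 1), θ x • U (φ k) t x)
          atTop (𝓝 (∫ x in ball (0 : EuclideanSpace ℝ (Fin 3)) (n + 1), θ x • u t x)) := by
    intro n θ hθ
    filter_upwards [hwP n θ hθ, hbox n] with t ht ht'
    have e : ∫ x in ball (0 : EuclideanSpace ℝ (Fin 3)) (n + 1), θ x • u t x =
        ∫ x in ball (0 : EuclideanSpace ℝ (Fin 3)) (n + 1), θ x • w n t x := by
      refine integral_congr_ae ?_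
      filter_upwards [ht'] with x hx
      change θ x • Ug (t, x) = θ x • uncurry (w n) (t, x)
      rw [hx]
    rw [e]
    exact ht
  -- the `L^{10/3}` bounds
  have hM : ∀ n : ℕ, ∃ M : ℝ≥0∞, M < ∞ ∧
      (∀ k, ∫⁻ z in Q n, ‖U k z.1 z.2‖ₑ ^ (10 / 3 : ℝ) ≤ M) ∧
      ∫⁻ z in Q n, ‖u z.1 z.2‖ₑ ^ (10 / 3 : ℝ) ≤ M := by
    intro n
    obtain ⟨M, hMtop, hMb⟩ := exists_cylinder_tenThirds_bound hT C (-((n : ℝ) + 1)) ((n : ℝ) + 1)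
      ((n : ℝ) + 1)
    have hvb : ∀ k, ∫⁻ z in Q n, ‖U k z.1 z.2‖ₑ ^ (10 / 3 : ℝ) ≤ M := fun k => hMb (hsol k)
    refine ⟨M, hMtop, hvb, ?_⟩
    exact FunctionSpaces.lintegral_enorm_rpow_le_of_tendsto_lintegral_sq
      (f := fun k => uncurry (U (φ k))) (g := uncurry u) (μ := volume.restrict (Q n))
      (fun k => hvm (φ k) n) (hum n) (hut n) _ fun k => hvb (φ k)
  refine ⟨φ, u, hφ, hUmeas, hub, hM, hut, fun n => ?_, huP⟩
  -- `L³` convergence by interpolation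
  obtain ⟨M, hMtop, hvb, -⟩ := hM n
  exact FunctionSpaces.tendsto_lintegral_enorm_rpow_three_of_sq_of_tenThirds
    (f := fun k => uncurry (U (φ k))) (g := uncurry u) (μ := volume.restrict (Q n))
    (fun k => hvm (φ k) n) (hum n) (hut n) hMtop.ne fun k => hvb (φ k)

/-- **The global slice bound of the limit**: if `∫_{B(0,n+1)} |u(t)|² ≤ C` for a.e.
`t ∈ (−n−1, n+1)`, for every `n`, then `∫_{ℝ³} |u(t)|² ≤ C` for a.e. `t ∈ ℝ` (monotone
convergence over the balls). [folklore] -/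
theorem ae_lintegral_sq_le_of_forall_ball {u : ℝ → (EuclideanSpace ℝ (Fin 3)) → (EuclideanSpace ℝ (Fin 3))} {C : ℝ≥0∞}
    (h : ∀ n : ℕ, ∀ᵐ t ∂(volume.restrict (Ioo (-((n : ℝ) + 1)) ((n : ℝ) + 1))),
      ∫⁻ x in ball (0 : EuclideanSpace ℝ (Fin 3)) (n + 1), ‖u t x‖ₑ ^ 2 ≤ C) :
    ∀ᵐ t : ℝ, ∫⁻ x, ‖u t x‖ₑ ^ 2 ≤ C := by
  -- for a.e. `t`, the ball bounds hold for every `n` with `|t| < n + 1`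
  have h' : ∀ n : ℕ, ∀ᵐ t : ℝ, t ∈ Ioo (-((n : ℝ) + 1)) ((n : ℝ) + 1) →
      ∫⁻ x in ball (0 : EuclideanSpace ℝ (Fin 3)) (n + 1), ‖u t x‖ₑ ^ 2 ≤ C := fun n =>
    (ae_restrict_iff' measurableSet_Ioo).1 (h n)
  have hall : ∀ᵐ t : ℝ, ∀ n : ℕ, t ∈ Ioo (-((n : ℝ) + 1)) ((n : ℝ) + 1) →
      ∫⁻ x in ball (0 : EuclideanSpace ℝ (Fin 3)) (n + 1), ‖u t x‖ₑ ^ 2 ≤ C := ae_all_iff.2 h'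
  filter_upwards [hall] with t ht
  -- monotone convergence over the balls `B(0, n + 1)`, `n ≥ ⌊|t|⌋₊`
  have hmono : Monotone fun n : ℕ => ball (0 : EuclideanSpace ℝ (Fin 3)) ((n : ℝ) + ⌊|t|⌋₊ + 1) :=
    fun n m hnm => ball_subset_ball (by have : (n : ℝ) ≤ m := Nat.cast_le.2 hnm; linarith)
  have hunion : (⋃ n : ℕ, ball (0 : EuclideanSpace ℝ (Fin 3)) ((n : ℝ) + ⌊|t|⌋₊ + 1)) = univ := by
    refine eq_univ_of_forall fun x => mem_iUnion.2 ⟨⌊‖x‖⌋₊, ?_⟩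
    rw [mem_ball_zero_iff]
    have := Nat.lt_floor_add_one ‖x‖
    have h0 : (0 : ℝ) ≤ ⌊|t|⌋₊ := Nat.cast_nonneg _
    linarith
  have hlim := setLIntegral_iUnion_of_directed (μ := (volume : Measure (EuclideanSpace ℝ (Fin 3))))
    (fun x => ‖u t x‖ₑ ^ 2) hmono.directed_le
  rw [hunion, Measure.restrict_univ] at hlim
  rw [hlim]
  refine iSup_le fun n => ?_
  have hn : t ∈ Ioo (-(((n + ⌊|t|⌋₊ : ℕ) : ℝ) + 1)) (((n + ⌊|t|⌋₊ : ℕ) : ℝ) + 1) := by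
    have h1 : |t| < ⌊|t|⌋₊ + 1 := Nat.lt_floor_add_one _
    push_cast
    refine ⟨?_, ?_⟩
    · have h0 : (0 : ℝ) ≤ n := Nat.cast_nonneg _
      linarith [neg_abs_le t]
    · have h0 : (0 : ℝ) ≤ n := Nat.cast_nonneg _
      linarith [le_abs_self t]
  have := ht (n + ⌊|t|⌋₊) hn
  push_cast at this
  exact this

end Limit

end BradshawTsai2017

end Literature.Analysis.FluidPDE

end
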